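import Summits.ResolutionOfSingularities.ResolutionOfSingularities.Theorems.RadicialJungCleanModelsSufficeGameEndPoint
import Literature.AlgebraicGeometry.Resolution.StalkIdealGenerization
import Literature.AlgebraicGeometry.Resolution.PthRootChargeInvariance
import Literature.AlgebraicGeometry.Resolution.ResidueNotPthPower
import Literature.AlgebraicGeometry.Resolution.RsopLocalization
import Literature.RingTheory.RegularLocalRing.QuotientDVR

/-!
# Route `RadicialJung`, crux `CleanModelsSuffice`, line `Sketch`: the END STATE of the game —
# the charge of an exceptional divisor is locally constant along it; the toroidal locus is closed

Helper for the registered stub `stub_gameEndResolves` of the skeleton of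
`Summit.ResolutionOfSingularities.ResolutionOfSingularities.Theses.RadicialJung.CleanModelsSuffice`
(stmt-ResolutionOfSingularities-15883). The data of a `GameState` are stalk-local and a priori
unrelated between neighbouring points; this file proves the first consistency statement needed to
glue the Kummer charts of the end state:

* `y_pow_stalkSpecializes`, `radicand_of_primeOfSpecializes_eq` — the presentation at `x`, read in
  the local ring of a generisation `ζ ⤳ x` whose prime at `x` is `(u_ℓ)` (`ℓ` the label of an
  exceptional divisor `D`): `y_x^p = e · ϖ^{a_x(ℓ)}` with `e` a unit of the discrete valuation ring
  `𝒪_{V,ζ}` and, when `a_x(ℓ) = 0`, the residue of `e` is not a `p`-th power (the REG clause at `x`,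
  `residue_not_pth_power`);
* `chargedAt_iff_of_specializes` — **CHARGE CONSTANCY**: if the generic point `ζ` of the branch of
  `D` at `v` specialises to `w ∈ D`, then `D` is charged at `v` iff it is charged at `w` (the charge is
  the ramification behaviour of `L` along the discrete valuation of `ζ`, `charge_iff`);
* `exists_nhds_chargedAt_iff` — every `v` has a neighbourhood `U` on which the exceptional divisors
  through a point pass through `v` and have the same charge as at `v`;
* `isClosed_tor` — the toroidal locus `{v | some exceptional divisor is charged at v}` is closed.
-/

noncomputable section

set_option linter.dupNamespace false -- mandated namespace of this single-conjunct summit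

open CategoryTheory AlgebraicGeometry TopologicalSpace IsLocalRing
open Literature.AlgebraicGeometry.Resolution Literature.RingTheory.RegularLocalRing

namespace Summit.ResolutionOfSingularities.ResolutionOfSingularities.Theorems.RadicialJung.CleanModelsSuffice

attribute [local instance] stalkAlgebra isScalarTower_stalkAlgebra

namespace GameState

variable {p : ℕ} {V₀ : Scheme.{0}} [IsIntegral V₀] {L : Type} [Field L] [Algebra V₀.functionField L]
  {V : Scheme.{0}} [IsIntegral V] {π : V ⟶ V₀} [IsDominant π] (S : GameState p V₀ L V π)

/-! ## The presentation at `x` read at a generisation `ζ ⤳ x` -/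

/-- `𝒪_{V,x} → K(V)` factors through `𝒪_{V,ζ}` for `ζ ⤳ x`. [folklore] -/
theorem algebraMap_stalk_eq {ζ x : V} (h : ζ ⤳ x) (f : V.presheaf.stalk x) :
    algebraMap (V.presheaf.stalk x) V.functionField f =
      algebraMap (V.presheaf.stalk ζ) V.functionField ((V.presheaf.stalkSpecializes h).hom f) := by
  change (V.presheaf.stalkSpecializes _).hom f =
    (V.presheaf.stalkSpecializes h ≫ V.presheaf.stalkSpecializes _).hom f
  rw [TopCat.Presheaf.stalkSpecializes_comp]

section Presentation

variable [Algebra V.functionField L]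

/-- **`y_x^p = w_x ∏ u_i^{a_i}` through `𝒪_{V,ζ} → L`** for a generisation `ζ ⤳ x`. [folklore] -/
theorem y_pow_stalkSpecializes (H : S.EndHyp) {ζ x : V} (h : ζ ⤳ x) :
    S.y x ^ p = algebraMap (V.presheaf.stalk ζ) L
      ((V.presheaf.stalkSpecializes h).hom (S.w x * ∏ i, S.u x i ^ S.a x i)) := by
  rw [S.y_pow_stalk H x, IsScalarTower.algebraMap_apply (V.presheaf.stalk x) V.functionField L,
    algebraMap_stalk_eq h, ← IsScalarTower.algebraMap_apply]

omit [Algebra V.functionField L] in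
/-- The radicand at a generisation where all coordinates outside `T` become units is a unit times
the monomial in the coordinates of `T`. [folklore] -/
theorem radicand_stalkSpecializes {ζ x : V} (h : ζ ⤳ x) (T : Finset (Fin (S.d x)))
    (hunit : ∀ i, i ∉ T → IsUnit ((V.presheaf.stalkSpecializes h).hom (S.u x i))) :
    ∃ E : V.presheaf.stalk ζ, IsUnit E ∧
      (V.presheaf.stalkSpecializes h).hom (S.w x * ∏ i, S.u x i ^ S.a x i) =
        E * ∏ i ∈ T, (V.presheaf.stalkSpecializes h).hom (S.u x i) ^ S.a x i := by
  classical
  set σ := (V.presheaf.stalkSpecializes h).hom with hσ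
  refine ⟨σ (S.w x) * ∏ i ∈ Tᶜ, σ (S.u x i) ^ S.a x i, ?_, ?_⟩
  · refine ((S.isUnit_w x).map σ).mul ?_
    refine Finset.prod_induction _ IsUnit (fun _ _ => IsUnit.mul) isUnit_one fun i hi => ?_
    exact (hunit i (Finset.mem_compl.mp hi)).pow _
  · rw [map_mul, map_prod]
    simp only [map_pow]
    rw [← Finset.prod_mul_prod_compl T]
    ring

/-- **The presentation at `x` in the discrete valuation ring of a generisation along a divisor.**
Let `ζ ⤳ x`, `D` an exceptional divisor through `x` with label `ℓ`, and suppose the prime of `ζ`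
in `𝒪_{V,x}` is `(u_ℓ)` and `𝔪_ζ = (ϖ)`. Then `y_x^p = e ϖ^{a_x(ℓ)}` in `L` for a unit `e` of
`𝒪_{V,ζ}`, and if `a_x(ℓ) = 0` the residue of `e` is not a `p`-th power. [folklore] -/
theorem radicand_of_primeOfSpecializes_eq (H : S.EndHyp) {ζ x : V} (h : ζ ⤳ x)
    (D : {D : V.IdealSheafData // D ∈ S.E ∧ x ∈ D.support})
    (hP : primeOfSpecializes h = Ideal.span {S.u x (S.lab x D)}) (ϖ : V.presheaf.stalk ζ)
    (hϖ : maximalIdeal (V.presheaf.stalk ζ) = Ideal.span {ϖ}) :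
    ∃ e : V.presheaf.stalk ζ, IsUnit e ∧
      S.y x ^ p = algebraMap (V.presheaf.stalk ζ) L (e * ϖ ^ S.a x (S.lab x D)) ∧
      (S.a x (S.lab x D) = 0 → ∀ c d : V.presheaf.stalk ζ, d ∉ maximalIdeal (V.presheaf.stalk ζ) →
        d ^ p * e - c ^ p ∉ maximalIdeal (V.presheaf.stalk ζ)) := by
  classical
  haveI := S.isRegular x
  haveI := S.charP_stalk H x
  set ℓ := S.lab x D with hℓ
  set σ := (V.presheaf.stalkSpecializes h).hom with hσ
  letI := σ.toAlgebra
  set P : Ideal (V.presheaf.stalk x) := Ideal.span {S.u x ℓ} with hPdef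
  haveI hPp : P.IsPrime := by
    rw [hPdef, Ideal.span_singleton_prime ((RoundOff.isRsopPart_u S x).ne_zero ℓ)]
    exact (RoundOff.isRsopPart_u S x).prime ℓ
  haveI hloc : IsLocalization.AtPrime (V.presheaf.stalk ζ) P :=
    isLocalizationAtPrime_congr hP (isLocalizationAtPrime_stalkSpecializes h)
  -- the other coordinates become units, `u_ℓ` becomes a uniformizer
  have hunit : ∀ i, i ∉ ({ℓ} : Finset (Fin (S.d x))) → IsUnit (σ (S.u x i)) := by
    intro i hi
    rw [hσ, isUnit_stalkSpecializes_iff h, hP, Ideal.mem_span_singleton]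
    exact (RoundOff.isRsopPart_u S x).not_dvd fun h' => hi (Finset.mem_singleton.mpr h'.symm)
  have hmax : maximalIdeal (V.presheaf.stalk ζ) = Ideal.span {σ (S.u x ℓ)} := by
    rw [← IsLocalization.AtPrime.map_eq_maximalIdeal P (V.presheaf.stalk ζ), hPdef, Ideal.map_span,
      Set.image_singleton]
    rfl
  have hassoc : Associated ϖ (σ (S.u x ℓ)) := by
    rw [← Ideal.span_singleton_eq_span_singleton, ← hϖ, hmax]
  obtain ⟨u₀, hu₀⟩ := hassoc
  obtain ⟨E, hE, hrad⟩ := S.radicand_stalkSpecializes h {ℓ} hunit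
  rw [Finset.prod_singleton] at hrad
  refine ⟨E * (u₀ : V.presheaf.stalk ζ) ^ S.a x ℓ, hE.mul (u₀.isUnit.pow _), ?_, ?_⟩
  · rw [S.y_pow_stalkSpecializes H h, ← hσ, hrad, ← hu₀]
    congr 1
    ring
  · intro ha c d hd hmem
    rw [ha, pow_zero, mul_one] at hmem
    have hE' : E = σ (S.w x * ∏ i, S.u x i ^ S.a x i) := by rw [hrad, ha, pow_zero, mul_one]
    rw [hE'] at hmem
    -- clear denominators
    obtain ⟨⟨c₀, s₁⟩, hc⟩ := IsLocalization.mk'_surjective P.primeCompl c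
    obtain ⟨⟨d₀, s₂⟩, hdd⟩ := IsLocalization.mk'_surjective P.primeCompl d
    simp only at hc hdd
    have hd₀ : d₀ ∉ P := by
      rw [← hdd] at hd
      exact fun h' => hd ((IsLocalization.AtPrime.mk'_mem_maximal_iff (V.presheaf.stalk ζ) P d₀ s₂).mpr h')
    have hd₁ : (s₁ : V.presheaf.stalk x) * d₀ ∉ P := fun h' => (hPp.mem_or_mem h').elim s₁.2 hd₀
    set τ := algebraMap (V.presheaf.stalk x) (V.presheaf.stalk ζ) with hτ
    have hd₁R : τ ((s₁ : V.presheaf.stalk x) * d₀) = τ (s₁ : V.presheaf.stalk x) * τ (s₂ : V.presheaf.stalk x) * d := by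
      rw [map_mul, ← IsLocalization.mk'_spec' (V.presheaf.stalk ζ) d₀ s₂, hdd, mul_assoc]
    have hc₁R : τ ((s₂ : V.presheaf.stalk x) * c₀) = τ (s₁ : V.presheaf.stalk x) * τ (s₂ : V.presheaf.stalk x) * c := by
      rw [map_mul, ← IsLocalization.mk'_spec' (V.presheaf.stalk ζ) c₀ s₁, hc]
      ring
    have hmemA : ((s₁ : V.presheaf.stalk x) * d₀) ^ p * (S.w x * ∏ i, S.u x i ^ S.a x i) -
        ((s₂ : V.presheaf.stalk x) * c₀) ^ p ∈ P := by
      rw [← IsLocalization.AtPrime.to_map_mem_maximal_iff (V.presheaf.stalk ζ) P]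
      have h1 : τ (((s₁ : V.presheaf.stalk x) * d₀) ^ p *
          (S.w x * ∏ i, S.u x i ^ S.a x i) - ((s₂ : V.presheaf.stalk x) * c₀) ^ p) =
          (τ (s₁ : V.presheaf.stalk x) * τ (s₂ : V.presheaf.stalk x)) ^ p *
            (d ^ p * σ (S.w x * ∏ i, S.u x i ^ S.a x i) - c ^ p) := by
        rw [map_sub, map_mul, map_pow, map_pow, hd₁R, hc₁R]
        change _ * σ _ - _ = _
        ring
      change τ _ ∈ _
      rw [h1]
      exact Ideal.mul_mem_left _ _ hmem
    exact residue_not_pth_power p H.prime (S.u x) (S.span_u x) (S.spanFinrank_eq x) (S.a x) (S.a_spec x)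
      (S.w x) (S.isUnit_w x) (Set.range (S.lab x)) ℓ ⟨D, rfl⟩ ha (S.reg x) _ _ hd₁ hmemA

end Presentation

/-! ## The generic point of the branch of a divisor at a point -/

/-- The prime `(u_i)` of `𝒪_{V,v}`. [folklore] -/
def qOf (S : GameState p V₀ L V π) (v : V) (i : Fin (S.d v)) : PrimeSpectrum (V.presheaf.stalk v) :=
  ⟨Ideal.span {S.u v i},
    (Ideal.span_singleton_prime ((RoundOff.isRsopPart_u S v).ne_zero i)).mpr ((RoundOff.isRsopPart_u S v).prime i)⟩

/-- The generic point of the branch `u_i = 0` at `v`. [folklore] -/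
def genPt (S : GameState p V₀ L V π) (v : V) (i : Fin (S.d v)) : V :=
  V.fromSpecStalk v (S.qOf v i)

/-- The generic point of a branch at `v` specialises to `v`. [folklore] -/
theorem genPt_specializes (v : V) (i : Fin (S.d v)) : S.genPt v i ⤳ v :=
  fromSpecStalk_specializes _

/-- Its prime in `𝒪_{V,v}` is `(u_i)`. [folklore] -/
theorem primeOfSpecializes_genPt (v : V) (i : Fin (S.d v)) :
    primeOfSpecializes (S.genPt_specializes v i) = Ideal.span {S.u v i} :=
  primeOfSpecializes_fromSpecStalk (S.qOf v i)

/-- At a second point `w ∈ D` under the generic point of the branch of `D` at `v`, the prime of the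
generic point is again the label coordinate of `D`. [folklore] -/
theorem primeOfSpecializes_genPt_eq {v w : V} (D : V.IdealSheafData) (hDv : D ∈ S.E ∧ v ∈ D.support)
    (hDw : D ∈ S.E ∧ w ∈ D.support) (hw : S.genPt v (S.lab v ⟨D, hDv⟩) ⤳ w) :
    primeOfSpecializes hw = Ideal.span {S.u w (S.lab w ⟨D, hDw⟩)} := by
  haveI : (Ideal.span {S.u w (S.lab w ⟨D, hDw⟩)}).IsPrime := (S.qOf w _).2
  refine primeOfSpecializes_eq_of_map_eq (S.genPt_specializes v _) hw _ ?_
  rw [S.primeOfSpecializes_genPt, ← S.stalkIdeal_lab w ⟨D, hDw⟩, ← S.stalkIdeal_lab v ⟨D, hDv⟩,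
    stalkIdeal_map_stalkSpecializes, stalkIdeal_map_stalkSpecializes]

/-- The local ring at the generic point of a branch of a divisor is a discrete valuation ring with
uniformizer the image of the label coordinate. [folklore] -/
theorem dvr_genPt (v : V) (i : Fin (S.d v)) :
    IsDiscreteValuationRing (V.presheaf.stalk (S.genPt v i)) ∧
      maximalIdeal (V.presheaf.stalk (S.genPt v i)) =
        Ideal.span {(V.presheaf.stalkSpecializes (S.genPt_specializes v i)).hom (S.u v i)} := by
  haveI := S.isRegular v
  haveI := S.isRegular (S.genPt v i)
  letI := (V.presheaf.stalkSpecializes (S.genPt_specializes v i)).hom.toAlgebra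
  haveI hloc : IsLocalization.AtPrime (V.presheaf.stalk (S.genPt v i)) (S.qOf v i).asIdeal :=
    isLocalizationAtPrime_stalk_fromSpecStalk (S.qOf v i)
  have hmax : maximalIdeal (V.presheaf.stalk (S.genPt v i)) =
      Ideal.span {(V.presheaf.stalkSpecializes (S.genPt_specializes v i)).hom (S.u v i)} := by
    rw [← IsLocalization.AtPrime.map_eq_maximalIdeal (S.qOf v i).asIdeal (V.presheaf.stalk (S.genPt v i))]
    change Ideal.map _ (Ideal.span {S.u v i}) = _
    rw [Ideal.map_span, Set.image_singleton]
    rfl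
  refine ⟨?_, hmax⟩
  have hone : IsRsopPart ![S.u v i] := by
    have h := (RoundOff.isRsopPart_u S v).comp ![i] (fun a b _ => Subsingleton.elim a b)
    have heq : S.u v ∘ ![i] = ![S.u v i] := by ext k; fin_cases k; rfl
    rwa [heq] at h
  have hrange : Set.range ![S.u v i] = {S.u v i} := by
    ext x
    simp only [Set.mem_range, Set.mem_singleton_iff]
    exact ⟨fun ⟨k, hk⟩ => by fin_cases k; exact hk.symm, fun h => ⟨0, h.symm⟩⟩
  have hdim : ringKrullDim (V.presheaf.stalk (S.genPt v i)) = 1 := by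
    rw [IsLocalization.AtPrime.ringKrullDim_eq_height (S.qOf v i).asIdeal (V.presheaf.stalk (S.genPt v i))]
    change ((Ideal.span {S.u v i}).height : WithBot ℕ∞) = 1
    rw [← hrange, hone.height_span_range]
    rfl
  exact isDiscreteValuationRing_of_ringKrullDim_eq_one hdim

/-! ## Charge constancy -/

section Charge

variable [Algebra V.functionField L]

/-- **CHARGE CONSTANCY along an exceptional divisor.** Let `D ∈ E` pass through `v` and `w`, and
let the generic point of the branch of `D` at `v` specialise to `w`. Then `D` is charged at `v` iff
it is charged at `w`: both presentations `y_v`, `y_w ∈ L ∖ K(V)` are clean generators over the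
discrete valuation ring at that generic point, charged ones with exponent prime to `p`, uncharged
ones with non-`p`-th-power residue, and `charge_iff` applies. [folklore] -/
theorem chargedAt_iff_of_specializes (H : S.EndHyp) {v w : V} (D : V.IdealSheafData)
    (hDv : D ∈ S.E ∧ v ∈ D.support) (hDw : D ∈ S.E ∧ w ∈ D.support)
    (hw : S.genPt v (S.lab v ⟨D, hDv⟩) ⤳ w) : S.chargedAt D v ↔ S.chargedAt D w := by
  haveI := H.charP
  set ℓ := S.lab v ⟨D, hDv⟩ with hℓ
  set ζ := S.genPt v ℓ with hζ
  haveI := S.isRegular ζ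
  obtain ⟨hDVR, hmax⟩ := S.dvr_genPt v ℓ
  haveI := hDVR
  set ϖ := (V.presheaf.stalkSpecializes (S.genPt_specializes v ℓ)).hom (S.u v ℓ) with hϖ
  have hirr : Irreducible ϖ := (IsDiscreteValuationRing.irreducible_iff_uniformizer ϖ).mpr hmax
  obtain ⟨e₁, he₁, hyp₁, hNP₁⟩ := S.radicand_of_primeOfSpecializes_eq H (S.genPt_specializes v ℓ)
    ⟨D, hDv⟩ (S.primeOfSpecializes_genPt v ℓ) ϖ hmax
  obtain ⟨e₂, he₂, hyp₂, hNP₂⟩ := S.radicand_of_primeOfSpecializes_eq H hw ⟨D, hDw⟩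
    (S.primeOfSpecializes_genPt_eq D hDv hDw hw) ϖ hmax
  have key := charge_iff (R := V.presheaf.stalk ζ) (K := V.functionField) H.prime H.finrank hirr
    he₁.unit he₂.unit (S.a v ℓ) (S.a w (S.lab w ⟨D, hDw⟩)) (S.a_spec v _) (S.a_spec w _) (S.y v) (S.y w)
    (S.y_not_mem_range H v) (S.y_not_mem_range H w) (by rw [he₁.unit_spec]; exact hyp₁)
    (by rw [he₂.unit_spec]; exact hyp₂) (by rw [he₁.unit_spec]; exact hNP₁)
    (by rw [he₂.unit_spec]; exact hNP₂)
  rw [S.chargedAt_iff, S.chargedAt_iff]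
  constructor
  · rintro ⟨_, h⟩
    exact ⟨hDw, fun h2 => h (key.mpr h2)⟩
  · rintro ⟨_, h⟩
    exact ⟨hDv, fun h1 => h (key.mp h1)⟩

/-! ## Neighbourhoods; the toroidal locus is closed -/

omit [Algebra V.functionField L] in
/-- Every point has a neighbourhood meeting only the exceptional divisors through it. [folklore] -/
theorem exists_nhds_forall_mem_support (v : V) :
    ∃ U : V.Opens, v ∈ U ∧ ∀ w ∈ U, ∀ D ∈ S.E, w ∈ D.support → v ∈ D.support := by
  classical
  set B : Set V.IdealSheafData := {D | D ∈ S.E ∧ v ∉ D.support} with hB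
  have hBfin : B.Finite := (List.finite_toSet S.E).subset fun D hD => hD.1
  refine ⟨⟨⋂ D ∈ B, ((D.support : Set V))ᶜ, hBfin.isOpen_biInter fun D _ =>
    D.support.isClosed.isOpen_compl⟩, ?_, ?_⟩
  · simp only [Opens.mem_mk, Set.mem_iInter, Set.mem_compl_iff, SetLike.mem_coe]
    exact fun D hD => hD.2
  · intro w hw D hD hwD
    by_contra hv
    have hw' : w ∈ ⋂ D ∈ B, ((D.support : Set V))ᶜ := hw
    simp only [Set.mem_iInter, Set.mem_compl_iff, SetLike.mem_coe] at hw'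
    exact hw' D ⟨hD, hv⟩ hwD

omit [Algebra V.functionField L] in
/-- Every point has a neighbourhood on which each exceptional divisor through it is the closure of
the generic point of its branch. [folklore] -/
theorem exists_nhds_forall_genPt_specializes (hN : IsLocallyNoetherian V) (v : V) :
    ∃ U : V.Opens, v ∈ U ∧ ∀ w ∈ U, ∀ (D : V.IdealSheafData) (hD : D ∈ S.E ∧ v ∈ D.support),
      w ∈ D.support → S.genPt v (S.lab v ⟨D, hD⟩) ⤳ w := by
  classical
  have hU : ∀ D : {D : V.IdealSheafData // D ∈ S.E ∧ v ∈ D.support}, ∃ U : V.Opens, v ∈ U ∧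
      ∀ w ∈ U, w ∈ D.1.support → S.genPt v (S.lab v D) ⤳ w := by
    intro D
    obtain ⟨U, hvU, hU⟩ := exists_nhds_mem_support_iff_specializes v D.1 (S.qOf v (S.lab v D))
      (S.stalkIdeal_lab v D)
    exact ⟨U, hvU, fun w hw hwD => (hU w hw).mp hwD⟩
  choose U hvU hU using hU
  haveI : Finite {D : V.IdealSheafData // D ∈ S.E ∧ v ∈ D.support} :=
    Set.Finite.to_subtype ((List.finite_toSet S.E).subset fun D hD => hD.1)
  haveI := Fintype.ofFinite {D : V.IdealSheafData // D ∈ S.E ∧ v ∈ D.support}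
  refine ⟨⟨⋂ D, (U D : Set V), isOpen_iInter_of_finite fun D => (U D).isOpen⟩, ?_,
    fun w hw D hD hwD => ?_⟩
  · change v ∈ ⋂ D, (U D : Set V)
    exact Set.mem_iInter.mpr fun D => hvU D
  · have hw' : w ∈ ⋂ D, (U D : Set V) := hw
    exact hU ⟨D, hD⟩ w (Set.mem_iInter.mp hw' ⟨D, hD⟩) hwD

/-- **Every point has a neighbourhood on which the exceptional divisors through a point pass
through `v` with the same charge as at `v`.** [folklore] -/
theorem exists_nhds_chargedAt_iff (H : S.EndHyp) (v : V) :
    ∃ U : V.Opens, v ∈ U ∧ ∀ w ∈ U, ∀ D ∈ S.E, w ∈ D.support →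
      v ∈ D.support ∧ (S.chargedAt D w ↔ S.chargedAt D v) := by
  obtain ⟨U₁, hv₁, hU₁⟩ := S.exists_nhds_forall_mem_support v
  obtain ⟨U₂, hv₂, hU₂⟩ := S.exists_nhds_forall_genPt_specializes H.locallyNoetherian v
  refine ⟨U₁ ⊓ U₂, ⟨hv₁, hv₂⟩, fun w hw D hD hwD => ?_⟩
  have hvD : v ∈ D.support := hU₁ w hw.1 D hD hwD
  exact ⟨hvD, (S.chargedAt_iff_of_specializes H D ⟨hD, hvD⟩ ⟨hD, hwD⟩
    (hU₂ w hw.2 D ⟨hD, hvD⟩ hwD)).symm⟩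

/-- **The toroidal locus of an end state is closed.** [folklore] -/
theorem isClosed_tor (H : S.EndHyp) : IsClosed S.tor := by
  rw [← isOpen_compl_iff, isOpen_iff_forall_mem_open]
  intro v hv
  obtain ⟨U, hvU, hU⟩ := S.exists_nhds_chargedAt_iff H v
  refine ⟨U, fun w hw hwT => ?_, U.isOpen, hvU⟩
  obtain ⟨D, hD⟩ := hwT
  have hDE : D ∈ S.E := S.mem_E_of_chargedAt hD
  have hwD : w ∈ D.support := S.mem_support_of_chargedAt hD
  exact hv ⟨D, ((hU w hw D hDE hwD).2).mp hD⟩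

end Charge

end GameState

/-- The toroidal locus of an end state is closed (explicit-binder form, the registered interface of
this helper file). [folklore] -/
theorem gameState_isClosed_tor {p : ℕ} {V₀ : Scheme.{0}} [IsIntegral V₀] {L : Type} [Field L]
    [Algebra V₀.functionField L] {V : Scheme.{0}} [IsIntegral V] {π : V ⟶ V₀} [IsDominant π]
    (S : GameState p V₀ L V π) [Algebra V.functionField L] (H : S.EndHyp) : IsClosed S.tor :=
  S.isClosed_tor H

end Summit.ResolutionOfSingularities.ResolutionOfSingularities.Theorems.RadicialJung.CleanModelsSuffice

end
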